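import Mathlib
import HarnessLib
import Summits.CriticalPhenomena.PercolationContinuityZ3.Theorems.PercNearOneGluingNoHeavyLowerTailTwoCopyLadderAllGradesLemmaQ

/-!
# Spokes at all grades on the EXTENDED orbit: apex pendants and apex edges

Helper file for crux `stmt-CriticalPhenomena-4575` (new-inequality factory `prim-ineq-gen-1`, gen 20); memo
`run/shared/lean/prim/prim-ineq-gen-1/FINDING-28-lemma-Q-tower.md` §3.  Sequel to `…TwoCopyLadderAllGradesSide` (gen 19),
which proved that the all-grade side forms `Aq` (`A_q = p(c+p+m+d) + q·ps + (1−q)(md − cs)`) and `Dl = cs − md` stay in any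
positive cone along the orbit of the one-vertex side under terminal rungs, q-pendant edges at `u`, `w` and merging, whence
THEOREM L∞-spoke: the two-copy core `P_{G; av, au}(q;y)/q³ = Qspoke q y₂ K` has nonnegative coefficients in `q` and all
weights when the far side `K` of the 2-separation `{u,w}` is a ladder side.
Here three further q-moves are added — `qpendX` (a pendant edge at the APEX: new apex `x'` joined to `x`; the old apex
floats, weight `q`, iff its block holds no terminal), `edgeXU` / `edgeXW` (an edge of weight `ρ` between the apex and the
terminal `u` / `w`) — with the exact identities (found by the tower LP of the memo, kit jobs j135374/j135375; all by `ring`)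
    `Aq (qpendX) = ρ(ρ+q)·Aq`,  `Aq (edgeXU) = Aq + ρ(2p + qs)Z + ρ²(p+s)Z` (`Z = c+p+m+d+s`),  `Aq (edgeXW) = (1+ρ)·Aq`,
    `Dl (qpendX) = ρ(ρ+q)·Dl + ρ·cp`,  `Dl (edgeXU) = Dl + ρ·s(c+m+d)`,  `Dl (edgeXW) = (1+ρ)·Dl + ρ·ps`,
and their mirror images.  Hence (`goodX_of_orbX`) `Aq`, `Ã_q = Aq ∘ mir`, `Dl`, `Dl ∘ mir` lie in the cone on the whole extended
orbit `OrbX` (sides built from one vertex by pendants at any of the three specials, edges between any two specials, merging: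
fans, wheels with a marked rim edge, triangulated bands, ladder sides with extra apex edges and diagonals, …), and
THEOREM L∞-spoke holds there (`Qspoke_pos_of_orbX`; real form `spokeX_allq_nonneg`, graded form `spokeX_coeff_nonneg`):
for every graph `G` with `G ∖ {av} = {au, aw} ∪_{u,w} K`, `K ∈ OrbX` with apex `v`, the pair `(av, au)` is coefficientwise
Rayleigh (`P_{G; av, au}(q;y) ∈ ℕ[q,y]`) — by memo F-26 §8 / lit-2 g84 this is Mani's Conjecture 46 (= CONJECTURE A) for these
adjacent pairs (all adjacent pairs of all connected graphs on ≤ 4 vertices, 84 % on 5, 67 % on 6, 44 % on 7 vertices are of this form;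
seat `lab/census/coverage.py`).  NOT formalised: the identification of `OrbX` with graph sides (finite type bookkeeping, memo §3).
(This work, 2026-08-21.)
-/

namespace Summit.CriticalPhenomena.PercolationContinuityZ3.Theorems

namespace TwoCopyLadderAllGrades

open TwoCopyLadderCubic

variable {R : Type*} [CommRing R]

/-- q-pendant edge of weight `ρ` at the APEX (new apex `x'` joined to `x`): `c ↦ ρc`, `p ↦ ρp`, `m ↦ ρm`,
`d ↦ ρd + qd + c`, `s ↦ ρs + qs + p + m` (the old apex floats, weight `q`, iff its block held no terminal). [this work] -/
def qpendX (q ρ : R) (L : SVec R) : SVec R :=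
  { c := ρ * L.c, p := ρ * L.p, m := ρ * L.m, d := ρ * L.d + q * L.d + L.c, s := ρ * L.s + q * L.s + L.p + L.m }

/-- An edge of weight `ρ` between the apex and the terminal `u`: `c ↦ c + ρ(c+m+d)`, `p ↦ p + ρ(p+s)` (q-free). [this work] -/
def edgeXU (ρ : R) (L : SVec R) : SVec R :=
  { c := L.c + ρ * (L.c + L.m + L.d), p := L.p + ρ * (L.p + L.s), m := L.m, d := L.d, s := L.s }

/-- An edge of weight `ρ` between the apex and the terminal `w` (mirror of `edgeXU`). [this work] -/
def edgeXW (ρ : R) (L : SVec R) : SVec R :=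
  { c := L.c + ρ * (L.c + L.p + L.d), p := L.p, m := L.m + ρ * (L.m + L.s), d := L.d, s := L.s }

/-- `Aq` under the apex pendant: an exact multiple. [this work] -/
theorem Aq_qpendX (q ρ : R) (X : SVec R) : Aq q (qpendX q ρ X) = ρ * (ρ + q) * Aq q X := by
  simp only [Aq, qpendX]; ring

/-- Mirror `Aq` under the apex pendant. [this work] -/
theorem Aq_mir_qpendX (q ρ : R) (X : SVec R) : Aq q (mir (qpendX q ρ X)) = ρ * (ρ + q) * Aq q (mir X) := by
  simp only [Aq, mir, qpendX]; ring

/-- `Aq` under the apex–`u` edge: nonnegative remainder. [this work] -/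
theorem Aq_edgeXU (q ρ : R) (X : SVec R) : Aq q (edgeXU ρ X) =
    Aq q X + ρ * ((2 * X.p + q * X.s) * (X.c + X.p + X.m + X.d + X.s))
      + ρ ^ 2 * ((X.p + X.s) * (X.c + X.p + X.m + X.d + X.s)) := by
  simp only [Aq, edgeXU]; ring

/-- Mirror `Aq` under the apex–`u` edge: an exact multiple. [this work] -/
theorem Aq_mir_edgeXU (q ρ : R) (X : SVec R) : Aq q (mir (edgeXU ρ X)) = (1 + ρ) * Aq q (mir X) := by
  simp only [Aq, mir, edgeXU]; ring

/-- `Aq` under the apex–`w` edge: an exact multiple. [this work] -/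
theorem Aq_edgeXW (q ρ : R) (X : SVec R) : Aq q (edgeXW ρ X) = (1 + ρ) * Aq q X := by
  simp only [Aq, edgeXW]; ring

/-- Mirror `Aq` under the apex–`w` edge: nonnegative remainder. [this work] -/
theorem Aq_mir_edgeXW (q ρ : R) (X : SVec R) : Aq q (mir (edgeXW ρ X)) =
    Aq q (mir X) + ρ * ((2 * X.m + q * X.s) * (X.c + X.p + X.m + X.d + X.s))
      + ρ ^ 2 * ((X.m + X.s) * (X.c + X.p + X.m + X.d + X.s)) := by
  simp only [Aq, mir, edgeXW]; ring

/-- `Dl` under the apex pendant. [this work] -/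
theorem Dl_qpendX (q ρ : R) (X : SVec R) : Dl (qpendX q ρ X) = ρ * (ρ + q) * Dl X + ρ * (X.c * X.p) := by
  simp only [Dl, qpendX]; ring

/-- Mirror `Dl` under the apex pendant. [this work] -/
theorem Dl_mir_qpendX (q ρ : R) (X : SVec R) :
    Dl (mir (qpendX q ρ X)) = ρ * (ρ + q) * Dl (mir X) + ρ * (X.c * X.m) := by
  simp only [Dl, mir, qpendX]; ring

/-- `Dl` under the apex–`u` edge. [this work] -/
theorem Dl_edgeXU (ρ : R) (X : SVec R) : Dl (edgeXU ρ X) = Dl X + ρ * (X.s * (X.c + X.m + X.d)) := by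
  simp only [Dl, edgeXU]; ring

/-- Mirror `Dl` under the apex–`u` edge. [this work] -/
theorem Dl_mir_edgeXU (ρ : R) (X : SVec R) : Dl (mir (edgeXU ρ X)) = (1 + ρ) * Dl (mir X) + ρ * (X.m * X.s) := by
  simp only [Dl, mir, edgeXU]; ring

/-- `Dl` under the apex–`w` edge. [this work] -/
theorem Dl_edgeXW (ρ : R) (X : SVec R) : Dl (edgeXW ρ X) = (1 + ρ) * Dl X + ρ * (X.p * X.s) := by
  simp only [Dl, edgeXW]; ring

/-- Mirror `Dl` under the apex–`w` edge. [this work] -/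
theorem Dl_mir_edgeXW (ρ : R) (X : SVec R) : Dl (mir (edgeXW ρ X)) = Dl (mir X) + ρ * (X.s * (X.c + X.p + X.d)) := by
  simp only [Dl, mir, edgeXW]; ring

/-- Mirror `Aq` under a pendant at `u`: the (mirrored) spoke expansion. [this work] -/
theorem Aq_mir_qpendU (q ρ : R) (X : SVec R) : Aq q (mir (qpendU q ρ X)) =
    ρ ^ 2 * Aq q (mir X) + ρ * (2 * X.c * X.m + X.c ^ 2 + q * (2 * X.m * X.d + 2 * X.m * X.p + 2 * X.m ^ 2
      + X.c * X.d + X.c * X.p + X.c * X.m) + q ^ 2 * (2 * X.m * X.s + X.c * X.s))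
      + (X.c + q * X.m) * (X.c + q * (X.m + X.p + X.d) + q ^ 2 * X.s) := by
  simp only [Aq, mir, qpendU]; ring

/-- Mirror `Aq` under a pendant at `w`: an exact multiple. [this work] -/
theorem Aq_mir_qpendW (q ρ : R) (X : SVec R) : Aq q (mir (qpendW q ρ X)) = ρ * (ρ + q) * Aq q (mir X) := by
  simp only [Aq, mir, qpendW]; ring

/-- Mirror `Dl` under a pendant at `u`. [this work] -/
theorem Dl_mir_qpendU (q ρ : R) (X : SVec R) :
    Dl (mir (qpendU q ρ X)) = ρ ^ 2 * Dl (mir X) + ρ * (q * X.c * X.s + X.c * X.d + X.c * X.p) := by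
  simp only [Dl, mir, qpendU]; ring

/-- Mirror `Dl` under a pendant at `w`. [this work] -/
theorem Dl_mir_qpendW (q ρ : R) (X : SVec R) :
    Dl (mir (qpendW q ρ X)) = ρ * (ρ + q) * Dl (mir X) + ρ * (X.c * X.m) := by
  simp only [Dl, mir, qpendW]; ring

variable {P : R → Prop}

/-- The EXTENDED orbit: S-vectors reachable from the one-vertex side by terminal rungs, q-pendant edges at `u`, `w` or the apex,
apex–terminal edges, and merging, with weights in the cone. [this work] -/
inductive OrbX (P : R → Prop) (q : R) : SVec R → Prop
  /-- the one-vertex side -/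
  | triv : OrbX P q triv
  /-- an edge of weight `t` between the terminals -/
  | rung {t : R} {X : SVec R} : P t → OrbX P q X → OrbX P q (rungStep t X)
  /-- a pendant edge of weight `ρ` at `u` -/
  | pendU {ρ : R} {X : SVec R} : P ρ → OrbX P q X → OrbX P q (qpendU q ρ X)
  /-- a pendant edge of weight `ρ` at `w` -/
  | pendW {ρ : R} {X : SVec R} : P ρ → OrbX P q X → OrbX P q (qpendW q ρ X)
  /-- a pendant edge of weight `ρ` at the apex -/
  | pendX {ρ : R} {X : SVec R} : P ρ → OrbX P q X → OrbX P q (qpendX q ρ X)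
  /-- an edge of weight `ρ` between the apex and `u` -/
  | edgeU {ρ : R} {X : SVec R} : P ρ → OrbX P q X → OrbX P q (edgeXU ρ X)
  /-- an edge of weight `ρ` between the apex and `w` -/
  | edgeW {ρ : R} {X : SVec R} : P ρ → OrbX P q X → OrbX P q (edgeXW ρ X)
  /-- identification of the terminals -/
  | merge {X : SVec R} : OrbX P q X → OrbX P q (mergeUW X)

/-- The ladder orbit is contained in the extended orbit. [this work] -/
theorem orbX_of_orb {q : R} {X : SVec R} (h : Orb P q X) : OrbX P q X := by
  induction h with
  | triv => exact OrbX.triv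
  | rung ht _ ih => exact OrbX.rung ht ih
  | pendU hρ _ ih => exact OrbX.pendU hρ ih
  | pendW hρ _ ih => exact OrbX.pendW hρ ih
  | merge _ ih => exact OrbX.merge ih

/-- The invariant on the extended orbit: entries, `Aq`, `Dl` and their mirror images lie in the cone. [this work] -/
structure GoodX (P : R → Prop) (q : R) (X : SVec R) : Prop where
  /-- `c ∈ P` -/
  hc : P X.c
  /-- `p ∈ P` -/
  hp : P X.p
  /-- `m ∈ P` -/
  hm : P X.m
  /-- `d ∈ P` -/
  hd : P X.d
  /-- `s ∈ P` -/
  hs : P X.s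
  /-- `Aq ∈ P` -/
  hA : P (Aq q X)
  /-- mirror `Aq ∈ P` -/
  hAm : P (Aq q (mir X))
  /-- `Dl ∈ P` -/
  hD : P (Dl X)
  /-- mirror `Dl ∈ P` -/
  hDm : P (Dl (mir X))

/-- `triv` is good. [this work] -/
theorem goodX_triv (hP : IsPosCone P) (q : R) : GoodX P q (triv : SVec R) := by
  refine ⟨?_, ?_, ?_, ?_, ?_, ?_, ?_, ?_, ?_⟩
  · show P 1; exact hP.one
  · show P 0; exact hP.zero
  · show P 0; exact hP.zero
  · show P 0; exact hP.zero
  · show P 0; exact hP.zero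
  · have e : Aq q (triv : SVec R) = 0 := by unfold Aq triv; ring
    rw [e]; exact hP.zero
  · have e : Aq q (mir (triv : SVec R)) = 0 := by unfold Aq mir triv; ring
    rw [e]; exact hP.zero
  · have e : Dl (triv : SVec R) = 0 := by unfold Dl triv; ring
    rw [e]; exact hP.zero
  · have e : Dl (mir (triv : SVec R)) = 0 := by unfold Dl mir triv; ring
    rw [e]; exact hP.zero

/-- A terminal rung preserves the invariant. [this work] -/
theorem goodX_rungStep (hP : IsPosCone P) {q t : R} (ht : P t) {X : SVec R} (h : GoodX P q X) :
    GoodX P q (rungStep t X) := by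
  obtain ⟨hc, hp, hm, hd, hs, hA, hAm, hD, hDm⟩ := h
  refine ⟨?_, hp, hm, ?_, hs, ?_, ?_, ?_, ?_⟩
  · show P (X.c + t * (X.c + X.p + X.m)); apply_rules (maxDepth := 3000) [hP.add, hP.mul, hP.pow, hP.zero, hP.one, hP.ofNat]
  · show P (X.d + t * (X.d + X.s)); apply_rules (maxDepth := 3000) [hP.add, hP.mul, hP.pow, hP.zero, hP.one, hP.ofNat]
  · rw [Aq_rungStep]; apply_rules (maxDepth := 3000) [hP.add, hP.mul, hP.pow, hP.zero, hP.one, hP.ofNat]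
  · rw [Aq_mir_rungStep]; apply_rules (maxDepth := 3000) [hP.add, hP.mul, hP.pow, hP.zero, hP.one, hP.ofNat]
  · rw [Dl_rungStep]; apply_rules (maxDepth := 3000) [hP.add, hP.mul, hP.pow, hP.zero, hP.one, hP.ofNat]
  · rw [Dl_mir_rungStep]; apply_rules (maxDepth := 3000) [hP.add, hP.mul, hP.pow, hP.zero, hP.one, hP.ofNat]

/-- A pendant edge at `u` preserves the invariant. [this work] -/
theorem goodX_qpendU (hP : IsPosCone P) {q ρ : R} (hq : P q) (hρ : P ρ) {X : SVec R} (h : GoodX P q X) :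
    GoodX P q (qpendU q ρ X) := by
  obtain ⟨hc, hp, hm, hd, hs, hA, hAm, hD, hDm⟩ := h
  refine ⟨?_, ?_, ?_, ?_, ?_, ?_, ?_, ?_, ?_⟩
  · show P (ρ * X.c); apply_rules (maxDepth := 3000) [hP.add, hP.mul, hP.pow, hP.zero, hP.one, hP.ofNat]
  · show P (ρ * X.p); apply_rules (maxDepth := 3000) [hP.add, hP.mul, hP.pow, hP.zero, hP.one, hP.ofNat]
  · show P (ρ * X.m + q * X.m + X.c); apply_rules (maxDepth := 3000) [hP.add, hP.mul, hP.pow, hP.zero, hP.one, hP.ofNat]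
  · show P (ρ * X.d); apply_rules (maxDepth := 3000) [hP.add, hP.mul, hP.pow, hP.zero, hP.one, hP.ofNat]
  · show P (ρ * X.s + q * X.s + X.d + X.p); apply_rules (maxDepth := 3000) [hP.add, hP.mul, hP.pow, hP.zero, hP.one, hP.ofNat]
  · rw [Aq_qpendU]; apply_rules (maxDepth := 3000) [hP.add, hP.mul, hP.pow, hP.zero, hP.one, hP.ofNat]
  · rw [Aq_mir_qpendU]
    apply_rules (maxDepth := 3000) [hP.add, hP.mul, hP.pow, hP.zero, hP.one, hP.ofNat]
  · rw [Dl_qpendU]; apply_rules (maxDepth := 3000) [hP.add, hP.mul, hP.pow, hP.zero, hP.one, hP.ofNat]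
  · rw [Dl_mir_qpendU]; apply_rules (maxDepth := 3000) [hP.add, hP.mul, hP.pow, hP.zero, hP.one, hP.ofNat]

/-- A pendant edge at `w` preserves the invariant. [this work] -/
theorem goodX_qpendW (hP : IsPosCone P) {q ρ : R} (hq : P q) (hρ : P ρ) {X : SVec R} (h : GoodX P q X) :
    GoodX P q (qpendW q ρ X) := by
  obtain ⟨hc, hp, hm, hd, hs, hA, hAm, hD, hDm⟩ := h
  refine ⟨?_, ?_, ?_, ?_, ?_, ?_, ?_, ?_, ?_⟩
  · show P (ρ * X.c); apply_rules (maxDepth := 3000) [hP.add, hP.mul, hP.pow, hP.zero, hP.one, hP.ofNat]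
  · show P (ρ * X.p + q * X.p + X.c); apply_rules (maxDepth := 3000) [hP.add, hP.mul, hP.pow, hP.zero, hP.one, hP.ofNat]
  · show P (ρ * X.m); apply_rules (maxDepth := 3000) [hP.add, hP.mul, hP.pow, hP.zero, hP.one, hP.ofNat]
  · show P (ρ * X.d); apply_rules (maxDepth := 3000) [hP.add, hP.mul, hP.pow, hP.zero, hP.one, hP.ofNat]
  · show P (ρ * X.s + q * X.s + X.d + X.m); apply_rules (maxDepth := 3000) [hP.add, hP.mul, hP.pow, hP.zero, hP.one, hP.ofNat]
  · rw [Aq_qpendW]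
    apply_rules (maxDepth := 3000) [hP.add, hP.mul, hP.pow, hP.zero, hP.one, hP.ofNat]
  · rw [Aq_mir_qpendW]; apply_rules (maxDepth := 3000) [hP.add, hP.mul, hP.pow, hP.zero, hP.one, hP.ofNat]
  · rw [Dl_qpendW]; apply_rules (maxDepth := 3000) [hP.add, hP.mul, hP.pow, hP.zero, hP.one, hP.ofNat]
  · rw [Dl_mir_qpendW]; apply_rules (maxDepth := 3000) [hP.add, hP.mul, hP.pow, hP.zero, hP.one, hP.ofNat]

/-- A pendant edge at the apex preserves the invariant. [this work] -/
theorem goodX_qpendX (hP : IsPosCone P) {q ρ : R} (hq : P q) (hρ : P ρ) {X : SVec R} (h : GoodX P q X) :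
    GoodX P q (qpendX q ρ X) := by
  obtain ⟨hc, hp, hm, hd, hs, hA, hAm, hD, hDm⟩ := h
  refine ⟨?_, ?_, ?_, ?_, ?_, ?_, ?_, ?_, ?_⟩
  · show P (ρ * X.c); apply_rules (maxDepth := 3000) [hP.add, hP.mul, hP.pow, hP.zero, hP.one, hP.ofNat]
  · show P (ρ * X.p); apply_rules (maxDepth := 3000) [hP.add, hP.mul, hP.pow, hP.zero, hP.one, hP.ofNat]
  · show P (ρ * X.m); apply_rules (maxDepth := 3000) [hP.add, hP.mul, hP.pow, hP.zero, hP.one, hP.ofNat]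
  · show P (ρ * X.d + q * X.d + X.c); apply_rules (maxDepth := 3000) [hP.add, hP.mul, hP.pow, hP.zero, hP.one, hP.ofNat]
  · show P (ρ * X.s + q * X.s + X.p + X.m); apply_rules (maxDepth := 3000) [hP.add, hP.mul, hP.pow, hP.zero, hP.one, hP.ofNat]
  · rw [Aq_qpendX]; apply_rules (maxDepth := 3000) [hP.add, hP.mul, hP.pow, hP.zero, hP.one, hP.ofNat]
  · rw [Aq_mir_qpendX]; apply_rules (maxDepth := 3000) [hP.add, hP.mul, hP.pow, hP.zero, hP.one, hP.ofNat]
  · rw [Dl_qpendX]; apply_rules (maxDepth := 3000) [hP.add, hP.mul, hP.pow, hP.zero, hP.one, hP.ofNat]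
  · rw [Dl_mir_qpendX]; apply_rules (maxDepth := 3000) [hP.add, hP.mul, hP.pow, hP.zero, hP.one, hP.ofNat]

/-- An apex–`u` edge preserves the invariant. [this work] -/
theorem goodX_edgeXU (hP : IsPosCone P) {q ρ : R} (hq : P q) (hρ : P ρ) {X : SVec R} (h : GoodX P q X) :
    GoodX P q (edgeXU ρ X) := by
  obtain ⟨hc, hp, hm, hd, hs, hA, hAm, hD, hDm⟩ := h
  refine ⟨?_, ?_, hm, hd, hs, ?_, ?_, ?_, ?_⟩
  · show P (X.c + ρ * (X.c + X.m + X.d)); apply_rules (maxDepth := 3000) [hP.add, hP.mul, hP.pow, hP.zero, hP.one, hP.ofNat]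
  · show P (X.p + ρ * (X.p + X.s)); apply_rules (maxDepth := 3000) [hP.add, hP.mul, hP.pow, hP.zero, hP.one, hP.ofNat]
  · rw [Aq_edgeXU]; apply_rules (maxDepth := 3000) [hP.add, hP.mul, hP.pow, hP.zero, hP.one, hP.ofNat]
  · rw [Aq_mir_edgeXU]; apply_rules (maxDepth := 3000) [hP.add, hP.mul, hP.pow, hP.zero, hP.one, hP.ofNat]
  · rw [Dl_edgeXU]; apply_rules (maxDepth := 3000) [hP.add, hP.mul, hP.pow, hP.zero, hP.one, hP.ofNat]
  · rw [Dl_mir_edgeXU]; apply_rules (maxDepth := 3000) [hP.add, hP.mul, hP.pow, hP.zero, hP.one, hP.ofNat]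

/-- An apex–`w` edge preserves the invariant. [this work] -/
theorem goodX_edgeXW (hP : IsPosCone P) {q ρ : R} (hq : P q) (hρ : P ρ) {X : SVec R} (h : GoodX P q X) :
    GoodX P q (edgeXW ρ X) := by
  obtain ⟨hc, hp, hm, hd, hs, hA, hAm, hD, hDm⟩ := h
  refine ⟨?_, hp, ?_, hd, hs, ?_, ?_, ?_, ?_⟩
  · show P (X.c + ρ * (X.c + X.p + X.d)); apply_rules (maxDepth := 3000) [hP.add, hP.mul, hP.pow, hP.zero, hP.one, hP.ofNat]
  · show P (X.m + ρ * (X.m + X.s)); apply_rules (maxDepth := 3000) [hP.add, hP.mul, hP.pow, hP.zero, hP.one, hP.ofNat]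
  · rw [Aq_edgeXW]; apply_rules (maxDepth := 3000) [hP.add, hP.mul, hP.pow, hP.zero, hP.one, hP.ofNat]
  · rw [Aq_mir_edgeXW]; apply_rules (maxDepth := 3000) [hP.add, hP.mul, hP.pow, hP.zero, hP.one, hP.ofNat]
  · rw [Dl_edgeXW]; apply_rules (maxDepth := 3000) [hP.add, hP.mul, hP.pow, hP.zero, hP.one, hP.ofNat]
  · rw [Dl_mir_edgeXW]; apply_rules (maxDepth := 3000) [hP.add, hP.mul, hP.pow, hP.zero, hP.one, hP.ofNat]

/-- Merging the terminals preserves the invariant. [this work] -/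
theorem goodX_mergeUW (hP : IsPosCone P) {q : R} {X : SVec R} (h : GoodX P q X) : GoodX P q (mergeUW X) := by
  obtain ⟨hc, hp, hm, hd, hs, hA, hAm, hD, hDm⟩ := h
  refine ⟨?_, ?_, ?_, ?_, ?_, ?_, ?_, ?_, ?_⟩
  · show P (X.c + X.p + X.m); apply_rules (maxDepth := 3000) [hP.add, hP.mul, hP.pow, hP.zero, hP.one, hP.ofNat]
  · show P 0; exact hP.zero
  · show P 0; exact hP.zero
  · show P (X.d + X.s); apply_rules (maxDepth := 3000) [hP.add, hP.mul, hP.pow, hP.zero, hP.one, hP.ofNat]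
  · show P 0; exact hP.zero
  · rw [Aq_mergeUW]; exact hP.zero
  · rw [Aq_mir_mergeUW]; exact hP.zero
  · rw [Dl_mergeUW]; exact hP.zero
  · rw [Dl_mir_mergeUW]; exact hP.zero

/-- Every vector of the EXTENDED orbit is good: `Aq`, `Ã_q`, `Dl`, `Dl ∘ mir` and the entries lie in the cone
(THEOREM L∞-spoke / LEMMA Δ on the extended orbit, memo §3). [this work] -/
theorem goodX_of_orbX (hP : IsPosCone P) {q : R} (hq : P q) {X : SVec R} (hX : OrbX P q X) : GoodX P q X := by
  induction hX with
  | triv => exact goodX_triv hP q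
  | rung ht _ ih => exact goodX_rungStep hP ht ih
  | pendU hρ _ ih => exact goodX_qpendU hP hq hρ ih
  | pendW hρ _ ih => exact goodX_qpendW hP hq hρ ih
  | pendX hρ _ ih => exact goodX_qpendX hP hq hρ ih
  | edgeU hρ _ ih => exact goodX_edgeXU hP hq hρ ih
  | edgeW hρ _ ih => exact goodX_edgeXW hP hq hρ ih
  | merge _ ih => exact goodX_mergeUW hP ih

/-- THEOREM L∞-spoke on the extended orbit (algebraic form): the spoke form `Qspoke q y₂ K = y₂²·Aq + y₂·Bq + C0q`
(`= P_{G; av, au}(q;y)/q³` when `G ∖ av = {au (= f), aw (= y₂)} ∪_{u,w} K`) lies in the cone for every `K ∈ OrbX`. [this work] -/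
theorem Qspoke_pos_of_orbX (hP : IsPosCone P) {q y₂ : R} (hq : P q) (hy : P y₂) {K : SVec R} (hK : OrbX P q K) :
    P (Qspoke q y₂ K) := by
  obtain ⟨hc, hp, hm, hd, hs, hA, hAm, hD, hDm⟩ := goodX_of_orbX hP hq hK
  unfold Qspoke Bq C0q
  apply_rules (maxDepth := 3000) [hP.add, hP.mul, hP.pow, hP.zero, hP.one, hP.ofNat]

/-- LEMMA Δ on the extended orbit: `cs − md ∈ P` (and `cs − pd ∈ P`). [this work] -/
theorem Dl_pos_of_orbX (hP : IsPosCone P) {q : R} (hq : P q) {K : SVec R} (hK : OrbX P q K) :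
    P (Dl K) ∧ P (Dl (mir K)) :=
  ⟨(goodX_of_orbX hP hq hK).hD, (goodX_of_orbX hP hq hK).hDm⟩

section Real

variable {S : Type*} [CommRing S] [LinearOrder S] [IsStrictOrderedRing S]

/-- THEOREM L∞-spoke on the extended orbit, real form: for every real `q ≥ 0`, `y₂ ≥ 0` and every side `K` of the extended orbit
with nonnegative weights, `P_{G; av, au}(q;y)/q³ = Qspoke q y₂ K ≥ 0` — for `0 < q < 1`, Rayleigh negative correlation of `av` and `au`
in the random-cluster model on `G` (`G ∖ av = {au, aw} ∪_{u,w} K`). [this work] -/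
theorem spokeX_allq_nonneg {q y₂ : S} (hq : 0 ≤ q) (hy₂ : 0 ≤ y₂) {K : SVec S} (hK : OrbX (fun x : S => 0 ≤ x) q K) :
    0 ≤ Qspoke q y₂ K :=
  Qspoke_pos_of_orbX (P := fun x : S => 0 ≤ x) isPosCone_nonneg hq hy₂ hK

end Real

section Graded

variable {S : Type*} [CommRing S] [LinearOrder S] [IsStrictOrderedRing S]

open Polynomial

/-- THEOREM L∞-spoke on the extended orbit, graded/coefficientwise form: with `q = X` and weights polynomials with nonnegative
coefficients, every coefficient of `Qspoke X y₂ K` is `≥ 0` for `K` in the extended orbit — `P_{G; av, au}(q; y) ∈ ℕ[q, y]`, i.e.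
CONJECTURE A (= Mani's Conjecture 46) for these adjacent pairs. [this work] -/
theorem spokeX_coeff_nonneg {y₂ : S[X]} (hy₂ : ∀ n, 0 ≤ y₂.coeff n) {K : SVec S[X]}
    (hK : OrbX (fun p : S[X] => ∀ n, 0 ≤ p.coeff n) X K) (n : ℕ) : 0 ≤ (Qspoke X y₂ K).coeff n :=
  Qspoke_pos_of_orbX (P := fun p : S[X] => ∀ n, 0 ≤ p.coeff n) isPosCone_coeff
    (fun n => by rw [coeff_X]; split_ifs <;> norm_num) hy₂ hK n

end Graded

end TwoCopyLadderAllGrades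

end Summit.CriticalPhenomena.PercolationContinuityZ3.Theorems
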